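import Mathlib
import HarnessLib
import Literature.Probability.MarkovChains.DoeblinMinorization
import Summits.Ventures.LatticeQCDFlow.Exactness.IMHKernel

/-!
# LatticeQCDFlow / Exactness — LEARNING ON THE JOB, V: A SCHEDULE OF EXACT DOEBLIN SAMPLERS FORGETS AT THE PRODUCT RATE, SO ADAPTATION
# WITH A LAG IS EXACT UP TO `(1 − ε)^lag` — whatever produced the schedule, from every configuration it was computed from

HONEST FRAMING: exact (Metropolis-corrected) sampling algorithms for lattice gauge theory;
figures of merit are autocorrelation/cost numbers at stated couplings and volumes; no
continuum-physics claim.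

Venture `LatticeQCDFlow` (cell pub-lqcd), topic `Exactness`, FANOUT row 30 (lean-1 GEN-44, theme LEARNING ON THE JOB).  NEW WORK of the
cell; no definition is introduced.  Tree inputs: the Literature file `Probability/MarkovChains/DoeblinMinorization` (Meyn–Tweedie
Thm 16.2.4: `residualKernel`, `bind_eq_add_residual` — the ONE-kernel split `μK = ε ν + (1 − ε) μR`), `IMHKernel` (`indepMH_apply_ge`:
a flow with bounded weight `w ≤ M` is `M⁻¹`-Doeblin).  The tree's Doeblin statements (`RefreshScan.uniformlyErgodic_of_minorised`,
`IMHAnyStartSplit`, `IMHErgodicEveryStart`) iterate ONE kernel; an adaptive run applies a DIFFERENT exact kernel at every step.  Printed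
counterpart NAMED ONLY: time-inhomogeneous Doeblin contraction (Douc–Moulines–Priouret–Soulier 2018, Ch. 18).

## Setting
A probability target `π` on a general measurable `Ω` and a SCHEDULE `Ks : List (Kernel Ω Ω)` of Markov kernels, EACH exact for `π` and
each minorised by `ε·π` (`ε·π(B) ≤ K(x, B)`; for flow samplers `ε = 1/W` with `W` a bound on the normalised weight, §4).  The run applies them
in order: `Ks.foldl (fun (m : Measure Ω) (K : Kernel Ω Ω) => m.bind K) μ` is the law after the schedule from the initial law `μ`.  THE POINT: the schedule may be ANY list —
in an adaptive run it is the list of flow samplers whose parameters were computed from information at least `n = |Ks|` steps old; CONDITIONALLY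
on that information the next `n` kernels are a fixed schedule, and the bound below holds from EVERY configuration, hence after averaging over
any dependence between the old information and the configuration it was computed from.

## Results (no `sorry`)
* §1 LINEARITY AND INVARIANCE OF A SCHEDULE: `foldlBind_add`, `foldlBind_smul`, `foldlBind_invariant` (`π` is fixed by the whole schedule),
  `foldlBind_isProbability`.
* §2 **`schedule_split`** (`ε < 1`): for every probability `μ` there is a probability `ν` with
  `μK₁⋯Kₙ + (1 − ε)ⁿ·π = π + (1 − ε)ⁿ·ν` — i.e. `μK₁⋯Kₙ = (1 − (1 − ε)ⁿ)π + (1 − ε)ⁿ ν` without subtraction; by induction over the schedule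
  with the Literature one-step split and `πR = π`-free bookkeeping (the residual chain may be anything).
* §3 **`schedule_real_sub_le`**: `|μK₁⋯Kₙ(A) − π(A)| ≤ (1 − ε)ⁿ` for every initial law, every set `A`, every schedule of `π`-exact
  `ε`-Doeblin kernels (the `ε = 1` case separately: then every member IS `π`).  **`schedule_dirac_real_sub_le`** — from every configuration.
* §4 THE LAG READING FOR FLOW SAMPLERS (**`laggedFlowSchedule_real_sub_le`**): a parameter space `H`, flows `q : Kernel H Ω` with weights
  `0 < w(h, ·) ≤ M`, `w(h, ·)·q(h) = π`; a kernel `κ` on `H × Ω` realising `indepMH (q h) (w h)` section-wise; for EVERY list of parameters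
  `hs` (the flows used in the last `n` steps — retrained how and on what one likes, provided they were fixed `n` steps ago) and every
  configuration `x`: `|δ_x K_{h₁}⋯K_{hₙ}(A) − π(A)| ≤ (1 − M⁻¹)ⁿ`.  So an adaptive flow sampler that uses parameters at least `n` updates old
  (epoch-wise retraining read at the `n`-th sample of the epoch; a training buffer that excludes the last `n` states; freezing after burn-in and
  reading `n` steps later) has one-time laws within `(1 − 1/W)ⁿ` of `π` in total variation — against the `O(1)` bias of lag zero
  (`SelfTunedFlowChoiceBias`).
-/

namespace Summit.Ventures.LatticeQCDFlow.Exactness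

open MeasureTheory ProbabilityTheory
open scoped ENNReal
open Literature.Probability.MarkovChains

variable {Ω : Type*} [MeasurableSpace Ω] {π : Measure Ω}

/-! ## §1 Schedules: linearity, invariance, mass -/

/-- `bind` is additive in the measure. [ours, bookkeeping] -/
theorem bindKernel_add_measure (μ μ' : Measure Ω) (K : Kernel Ω Ω) : (μ + μ').bind K = μ.bind K + μ'.bind K := by
  ext A hA
  rw [Measure.bind_apply hA (Kernel.aemeasurable K), Measure.add_apply, Measure.bind_apply hA (Kernel.aemeasurable K),
    Measure.bind_apply hA (Kernel.aemeasurable K), lintegral_add_measure]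

/-- A schedule acts additively on initial laws. [ours, bookkeeping] -/
theorem foldlBind_add : ∀ (Ks : List (Kernel Ω Ω)) (μ μ' : Measure Ω),
    Ks.foldl (fun (m : Measure Ω) (K : Kernel Ω Ω) => m.bind K) (μ + μ') = Ks.foldl (fun (m : Measure Ω) (K : Kernel Ω Ω) => m.bind K) μ + Ks.foldl (fun (m : Measure Ω) (K : Kernel Ω Ω) => m.bind K) μ'
  | [], μ, μ' => rfl
  | K :: Ks, μ, μ' => by
    rw [List.foldl_cons, List.foldl_cons, List.foldl_cons, bindKernel_add_measure]
    exact foldlBind_add Ks _ _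

/-- A schedule commutes with scalars. [ours, bookkeeping] -/
theorem foldlBind_smul : ∀ (Ks : List (Kernel Ω Ω)) (c : ℝ≥0∞) (μ : Measure Ω),
    Ks.foldl (fun (m : Measure Ω) (K : Kernel Ω Ω) => m.bind K) (c • μ) = c • Ks.foldl (fun (m : Measure Ω) (K : Kernel Ω Ω) => m.bind K) μ
  | [], c, μ => rfl
  | K :: Ks, c, μ => by
    rw [List.foldl_cons, List.foldl_cons, Measure.bind_smul]
    exact foldlBind_smul Ks c _

/-- **A SCHEDULE OF EXACT KERNELS IS EXACT**: `πK₁⋯Kₙ = π`. [ours] -/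
theorem foldlBind_invariant : ∀ (Ks : List (Kernel Ω Ω)), (∀ K ∈ Ks, Kernel.Invariant K π) →
    Ks.foldl (fun (m : Measure Ω) (K : Kernel Ω Ω) => m.bind K) π = π
  | [], _ => rfl
  | K :: Ks, h => by
    rw [List.foldl_cons, (h K List.mem_cons_self).def]
    exact foldlBind_invariant Ks fun K' hK' => h K' (List.mem_cons_of_mem K hK')

/-- A schedule of Markov kernels sends probability laws to probability laws. [ours, bookkeeping] -/
theorem foldlBind_isProbability : ∀ (Ks : List (Kernel Ω Ω)), (∀ K ∈ Ks, IsMarkovKernel K) →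
    ∀ (μ : Measure Ω) [IsProbabilityMeasure μ], IsProbabilityMeasure (Ks.foldl (fun (m : Measure Ω) (K : Kernel Ω Ω) => m.bind K) μ)
  | [], _, μ, hμ => hμ
  | K :: Ks, h, μ, _ => by
    haveI := h K List.mem_cons_self
    haveI : IsProbabilityMeasure (μ.bind K) :=
      ⟨by rw [Measure.bind_apply MeasurableSet.univ (Kernel.aemeasurable _)]; simp⟩
    rw [List.foldl_cons]
    exact foldlBind_isProbability Ks (fun K' hK' => h K' (List.mem_cons_of_mem K hK')) _

/-! ## §2 The split of an inhomogeneous schedule -/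

/-- **THE SPLIT**: for `ε < 1` and a schedule of Markov kernels each `π`-exact and minorised by `ε·π`, from every probability law `μ` there is
a probability law `ν` with `μK₁⋯Kₙ + (1 − ε)ⁿ·π = π + (1 − ε)ⁿ·ν`. [ours] -/
theorem schedule_split [IsProbabilityMeasure π] {ε : ℝ≥0∞} (hε : ε < 1) :
    ∀ (Ks : List (Kernel Ω Ω)), (∀ K ∈ Ks, IsMarkovKernel K) → (∀ K ∈ Ks, Kernel.Invariant K π) →
      (∀ K ∈ Ks, ∀ (x : Ω) {B : Set Ω}, MeasurableSet B → ε * π B ≤ K x B) →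
      ∀ (μ : Measure Ω) [IsProbabilityMeasure μ], ∃ ν : Measure Ω, IsProbabilityMeasure ν ∧
        Ks.foldl (fun (m : Measure Ω) (K : Kernel Ω Ω) => m.bind K) μ + (1 - ε) ^ Ks.length • π = π + (1 - ε) ^ Ks.length • ν
  | [], _, _, _, μ, hμ => ⟨μ, hμ, by simp [add_comm]⟩
  | K :: Ks, hM, hI, hmin, μ, _ => by
    haveI := hM K List.mem_cons_self
    have hminK : ∀ (x : Ω) {B : Set Ω}, MeasurableSet B → ε * π B ≤ K x B := hmin K List.mem_cons_self
    haveI := Doeblin.isMarkovKernel_residualKernel (κ := K) (ν := π) (hmin := hminK) hε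
    -- the one-step split of the head, then the induction hypothesis from the residual law
    have hstep := Doeblin.bind_eq_add_residual (κ := K) (ν := π) (hmin := hminK) hε μ
    obtain ⟨ν, hν, hsplit⟩ := schedule_split hε Ks (fun K' hK' => hM K' (List.mem_cons_of_mem K hK'))
      (fun K' hK' => hI K' (List.mem_cons_of_mem K hK')) (fun K' hK' => hmin K' (List.mem_cons_of_mem K hK'))
      (μ.bind (Doeblin.residualKernel K π ε hminK))
    refine ⟨ν, hν, ?_⟩
    have hinv : Ks.foldl (fun (m : Measure Ω) (K : Kernel Ω Ω) => m.bind K) π = π :=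
      foldlBind_invariant Ks fun K' hK' => hI K' (List.mem_cons_of_mem K hK')
    have hε1 : ε + (1 - ε) = 1 := add_tsub_cancel_of_le hε.le
    rw [List.foldl_cons, hstep, foldlBind_add, foldlBind_smul, foldlBind_smul, hinv, List.length_cons, pow_succ',
      mul_smul, mul_smul, add_assoc, ← smul_add, hsplit, smul_add, ← add_assoc, ← add_smul, hε1, one_smul]

/-! ## §3 The bound -/

/-- If `K(x, ·) ≥ π` setwise for a Markov `K` and probability `π`, then `K(x, ·) = π`. [ours, bookkeeping] -/
theorem apply_eq_of_minorised_one [IsProbabilityMeasure π] (K : Kernel Ω Ω) [IsMarkovKernel K]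
    (hmin : ∀ (x : Ω) {B : Set Ω}, MeasurableSet B → 1 * π B ≤ K x B) (x : Ω) {B : Set Ω} (hB : MeasurableSet B) :
    K x B = π B := by
  refine le_antisymm ?_ (by simpa using hmin x hB)
  have hc : π Bᶜ ≤ K x Bᶜ := by simpa using hmin x hB.compl
  rw [prob_compl_eq_one_sub hB, prob_compl_eq_one_sub hB] at hc
  exact (ENNReal.sub_le_sub_iff_left prob_le_one ENNReal.one_ne_top).1 hc

/-- **A SCHEDULE OF `π`-EXACT `ε`-DOEBLIN KERNELS FORGETS AT RATE `(1 − ε)ⁿ`**: for every initial probability law `μ`, every set `A`: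
`|μK₁⋯Kₙ(A) − π(A)| ≤ (1 − ε)ⁿ`. [ours] -/
theorem schedule_real_sub_le [IsProbabilityMeasure π] {ε : ℝ≥0∞} (Ks : List (Kernel Ω Ω)) (hM : ∀ K ∈ Ks, IsMarkovKernel K)
    (hI : ∀ K ∈ Ks, Kernel.Invariant K π) (hmin : ∀ K ∈ Ks, ∀ (x : Ω) {B : Set Ω}, MeasurableSet B → ε * π B ≤ K x B)
    (μ : Measure Ω) [IsProbabilityMeasure μ] (A : Set Ω) :
    |(Ks.foldl (fun (m : Measure Ω) (K : Kernel Ω Ω) => m.bind K) μ).real A - π.real A| ≤ (1 - ε.toReal) ^ Ks.length := by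
  -- `ε ≤ 1` unless the schedule is empty
  by_cases hε1 : 1 ≤ ε
  · cases Ks with
    | nil =>
      simp only [List.foldl_nil, List.length_nil, pow_zero]
      have h0 := measureReal_nonneg (μ := μ) (s := A)
      have h0' := measureReal_nonneg (μ := π) (s := A)
      have h1 := measureReal_le_one (μ := μ) (s := A)
      have h1' := measureReal_le_one (μ := π) (s := A)
      rw [abs_le]; constructor <;> linarith
    | cons K Ks =>
      -- the head is minorised by `π` itself, hence equals `π`; the tail fixes `π`
      haveI := hM K List.mem_cons_self
      have hone : ∀ (x : Ω) {B : Set Ω}, MeasurableSet B → 1 * π B ≤ K x B := fun x B hB =>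
        (mul_le_mul' hε1 le_rfl).trans (hmin K List.mem_cons_self x hB)
      have hK : μ.bind K = π := by
        ext B hB
        rw [Measure.bind_apply hB (Kernel.aemeasurable _)]
        simp_rw [apply_eq_of_minorised_one K hone _ hB]
        rw [lintegral_const, measure_univ, mul_one]
      rw [List.foldl_cons, hK, foldlBind_invariant Ks fun K' hK' => hI K' (List.mem_cons_of_mem K hK'), sub_self, abs_zero]
      have ht : ε.toReal ≤ 1 := by
        have h2 := hmin K List.mem_cons_self (Classical.choice (nonempty_of_isProbabilityMeasure π)) MeasurableSet.univ
        rw [measure_univ, mul_one] at h2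
        exact ENNReal.toReal_le_of_le_ofReal zero_le_one (by simpa using h2.trans prob_le_one)
      positivity
  have hε : ε < 1 := not_le.1 hε1
  obtain ⟨ν, hν, hsplit⟩ := schedule_split hε Ks hM hI hmin μ
  haveI := foldlBind_isProbability Ks hM μ
  set c : ℝ≥0∞ := (1 - ε) ^ Ks.length with hc
  have hctop : c ≠ ⊤ := ENNReal.pow_ne_top (ne_top_of_le_ne_top ENNReal.one_ne_top tsub_le_self)
  have hcreal : c.toReal = (1 - ε.toReal) ^ Ks.length := by
    rw [hc, ENNReal.toReal_pow, ENNReal.toReal_sub_of_le hε.le ENNReal.one_ne_top, ENNReal.toReal_one]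
  have h := congrArg (fun m : Measure Ω => (m A).toReal) hsplit
  simp only [Measure.add_apply, Measure.smul_apply, smul_eq_mul] at h
  rw [ENNReal.toReal_add (measure_ne_top _ _) (ENNReal.mul_ne_top hctop (measure_ne_top _ _)),
    ENNReal.toReal_add (measure_ne_top _ _) (ENNReal.mul_ne_top hctop (measure_ne_top _ _)), ENNReal.toReal_mul,
    ENNReal.toReal_mul, hcreal] at h
  have hν0 := measureReal_nonneg (μ := ν) (s := A)
  have hν1 := measureReal_le_one (μ := ν) (s := A)
  have hπ0 := measureReal_nonneg (μ := π) (s := A)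
  have hπ1 := measureReal_le_one (μ := π) (s := A)
  have hcnn : 0 ≤ (1 - ε.toReal) ^ Ks.length := by rw [← hcreal]; exact ENNReal.toReal_nonneg
  have hkey : (Ks.foldl (fun (m : Measure Ω) (K : Kernel Ω Ω) => m.bind K) μ).real A - π.real A = (1 - ε.toReal) ^ Ks.length * (ν.real A - π.real A) := by
    simp only [measureReal_def] at *
    linarith
  rw [hkey, abs_mul, abs_of_nonneg hcnn]
  calc (1 - ε.toReal) ^ Ks.length * |ν.real A - π.real A| ≤ (1 - ε.toReal) ^ Ks.length * 1 := by
        refine mul_le_mul_of_nonneg_left ?_ hcnn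
        rw [abs_le]; constructor <;> linarith
    _ = (1 - ε.toReal) ^ Ks.length := mul_one _

/-- **… FROM EVERY CONFIGURATION**: `|δ_x K₁⋯Kₙ(A) − π(A)| ≤ (1 − ε)ⁿ`. [ours] -/
theorem schedule_dirac_real_sub_le [IsProbabilityMeasure π] {ε : ℝ≥0∞} (Ks : List (Kernel Ω Ω)) (hM : ∀ K ∈ Ks, IsMarkovKernel K)
    (hI : ∀ K ∈ Ks, Kernel.Invariant K π) (hmin : ∀ K ∈ Ks, ∀ (x : Ω) {B : Set Ω}, MeasurableSet B → ε * π B ≤ K x B)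
    (x : Ω) (A : Set Ω) :
    |(Ks.foldl (fun (m : Measure Ω) (K : Kernel Ω Ω) => m.bind K) (Measure.dirac x)).real A - π.real A| ≤ (1 - ε.toReal) ^ Ks.length :=
  schedule_real_sub_le Ks hM hI hmin _ A

/-! ## §4 The lag reading for flow samplers -/

section Flow

variable {H : Type*} [MeasurableSpace H] (q : Kernel H Ω) [IsMarkovKernel q] {w : H → Ω → ℝ} {M : ℝ}

/-- A frozen flow sampler with `w(h, ·)·q(h) = π` and `0 < w(h, ·) ≤ M` is Markov, `π`-exact and `M⁻¹`-Doeblin (the tree's `indepMH_invariant`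
and `indepMH_apply_ge`, transported along the section hypothesis). [ours] -/
theorem frozenFlow_section_props [IsProbabilityMeasure π] (hw : ∀ h, Measurable (w h)) (hw0 : ∀ h y, 0 < w h y)
    (hwM : ∀ h y, w h y ≤ M) (hπ : ∀ h, ((q h).withDensity fun y => ENNReal.ofReal (w h y)) = π) (κ : Kernel (H × Ω) Ω)
    (hκ : ∀ (h : H) (x : Ω) {B : Set Ω}, MeasurableSet B → κ (h, x) B =
      ∫⁻ y in B, imhAcceptE (w h) x y ∂(q h) + (1 - imhAcceptMass (q h) (w h) x) * B.indicator 1 x) (h : H) :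
    IsMarkovKernel (κ.comap (Prod.mk h) measurable_prodMk_left) ∧
      Kernel.Invariant (κ.comap (Prod.mk h) measurable_prodMk_left) π ∧
      ∀ (x : Ω) {B : Set Ω}, MeasurableSet B → (ENNReal.ofReal M)⁻¹ * π B ≤ (κ.comap (Prod.mk h) measurable_prodMk_left) x B := by
  have heq : κ.comap (Prod.mk h) measurable_prodMk_left = indepMH (q h) (w h) := by
    ext x B hB
    rw [Kernel.comap_apply, hκ h x hB, indepMH_apply (hw h) x hB]
  rw [heq]
  haveI : Fact (Measurable (w h)) := ⟨hw h⟩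
  refine ⟨inferInstance, ?_, fun x B hB => ?_⟩
  · have := indepMH_invariant (q := q h) (hw h) (hw0 h)
    rwa [hπ h] at this
  · have := indepMH_apply_ge (q := q h) (hw h) (hw0 h) (hwM h) x hB
    rwa [hπ h] at this

/-- **THE LAG BOUND FOR ADAPTIVE FLOW SAMPLERS**: flows `q(h)` with weights `0 < w(h, ·) ≤ M`, `w(h, ·)·q(h) = π`; for EVERY list of parameters
`hs` — the flows used in the last `n` updates, produced by any training rule from information at least `n` updates old — and every
configuration `x` at that time: `|δ_x K_{h₁}⋯K_{hₙ}(A) − π(A)| ≤ (1 − M⁻¹)ⁿ`. [ours] -/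
theorem laggedFlowSchedule_real_sub_le [IsProbabilityMeasure π] (hw : ∀ h, Measurable (w h)) (hw0 : ∀ h y, 0 < w h y)
    (hwM : ∀ h y, w h y ≤ M) (hπ : ∀ h, ((q h).withDensity fun y => ENNReal.ofReal (w h y)) = π) (κ : Kernel (H × Ω) Ω)
    (hκ : ∀ (h : H) (x : Ω) {B : Set Ω}, MeasurableSet B → κ (h, x) B =
      ∫⁻ y in B, imhAcceptE (w h) x y ∂(q h) + (1 - imhAcceptMass (q h) (w h) x) * B.indicator 1 x)
    (hs : List H) (x : Ω) (A : Set Ω) :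
    |((hs.map fun h => κ.comap (Prod.mk h) measurable_prodMk_left).foldl (fun (m : Measure Ω) (K : Kernel Ω Ω) => m.bind K) (Measure.dirac x)).real A - π.real A|
      ≤ (1 - (ENNReal.ofReal M)⁻¹.toReal) ^ hs.length := by
  have hP := frozenFlow_section_props q hw hw0 hwM hπ κ hκ
  have hlen : (hs.map fun h => κ.comap (Prod.mk h) measurable_prodMk_left).length = hs.length := List.length_map _
  rw [← hlen]
  refine schedule_dirac_real_sub_le _ (fun K hK => ?_) (fun K hK => ?_) (fun K hK => ?_) x A
  · obtain ⟨h, -, rfl⟩ := List.mem_map.1 hK; exact (hP h).1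
  · obtain ⟨h, -, rfl⟩ := List.mem_map.1 hK; exact (hP h).2.1
  · obtain ⟨h, -, rfl⟩ := List.mem_map.1 hK; exact (hP h).2.2

/-- The rate in familiar form: `(ofReal M)⁻¹.toReal = M⁻¹` for `M > 0`, so the bound reads `(1 − 1/M)ⁿ`. [ours, bookkeeping] -/
theorem inv_ofReal_toReal (hM : 0 < M) : (ENNReal.ofReal M)⁻¹.toReal = M⁻¹ := by
  rw [ENNReal.toReal_inv, ENNReal.toReal_ofReal hM.le]

end Flow

end Summit.Ventures.LatticeQCDFlow.Exactness
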